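import Literature.NumberTheory.EllipticCurves.SelmerGaloisAction
import Literature.NumberTheory.EllipticCurves.OrdinaryLocalCondition
import HarnessLib

/-!
# Route `KolyvaginRoadThree`, deciding crux `ZhangSharpFrameAtThreeHL` (item stmt-BirchSwinnertonDyer-19574):
# (E1) — the LOCAL CONJUGATION TRANSPORT on `H¹(K_v, E[n])` in the method skeleton's `torsionLocMap` model:
# an injective `Φ : H¹(Γ_E, E(K̄_E)[n]) → H¹(Γ_{E'}, E(K̄_{E'})[n])` along a `σ`-semilinear `θ : E ≃+* E'` with
# `Φ ∘ loc_E = loc_{E'} ∘ σ_*` (`σ_* = conjAct W σ n`), and the transport of the STRICT local condition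
# (cell `bsd-stepL`, ACCEL seat `bsd-stepL-koly3b` g4; `--supports stmt-BirchSwinnertonDyer-19574`, helper; part VI of the
# (Supply) series — the first of the residual inputs (E1)–(E4) of the SIGNED supply listed in part V
# `KolyvaginRoadThreeZhangSupplySigned.lean`)

HONEST FRAMING. Theorems only; no definition (the transport is produced as an existential), no named fact, no `sorry`;
nothing at `p = 3 ∥ N` is asserted. Everything is the torsion-coefficient analogue of the tree's PROVED
`Literature.NumberTheory.EllipticCurves.conjAct_mem_selmerLocalKer_iff` (file `SelmerGaloisAction.lean`, which transports
the KUMMER condition `ker (H¹(K, E[n]) → H¹(E, E))`); here the coefficients are the `n`-torsion local points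
`E(K̄_E)[n]`, so that the transport is a map between the LOCAL groups `H¹(Γ_E, E(K̄_E)[n])` in which the method skeleton's
`WeierstrassCurve.torsionLocMap` takes values (the model of `Method2Defs.levelSelmerSubgroup`, `torsionLocalKer`,
`ordinaryLocalKer`). PARTITION: O2@3 (B10) × A1 × crux 19574 — none (engine input; types nothing, closes nothing; T7).

WHY. Part V isolated the residual of the SIGNED supply (McCallum 1991 Lemma 5.3) as: (E1) an action of complex
conjugation on the LOCAL groups compatible with `loc` and the global `conjAct`; (E2) invariance of the summed local
pairings; (E3) signed local counts; (E4) compatibility with the Weil transport. This file is (E1) for a general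
`σ ∈ Aut(K/ℚ)` and a `σ`-semilinear isomorphism `θ : E ≃+* E'` of `K`-fields — the case in point being the Galois
transport of completions `K_v ≃+* K_{σ v}` (`Literature.NumberTheory.Automorphic.galAdicCompletionEquiv`,
`isSemilinearRingEquiv_galAdicCompletionEquiv`):

* `exists_torsionBy_map` — a lift `Θ : K̄_E ≃+* K̄_{E'}` of `θ` acts on `n`-torsion local points,
  `E(K̄_E)[n] → E(K̄_{E'})[n]` (the tree's `localPointsMap W Θ` on coordinates), equivariantly for `Θ⁻¹(·)Θ`
  (`smul_of_coe_eq_localPointsMap`);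
* **`exists_transport_torsionLocMap`** — for `σ`, `θ` `σ`-semilinear, `n`: there is an INJECTIVE additive
  `Φ : H¹(Γ_E, E(K̄_E)[n]) → H¹(Γ_{E'}, E(K̄_{E'})[n])` with `Φ (loc_E s) = loc_{E'} (σ_* s)` for every `s ∈ H¹(K, E[n])`
  (`loc = WeierstrassCurve.torsionLocMap`, `σ_* = conjAct W σ n`). Proof = the tree's proof of
  `conjAct_mem_selmerLocalKer_iff` with torsion coefficients: `Φ = H¹` of the compatible pair `(Θ⁻¹(·)Θ, Θ)`, injective
  with left inverse the pair of `Θ⁻¹`; independence of the embedding `K̄ → K̄_{E'}` for the torsion localisation MAP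
  (`map_torsion_eq_of_algHom`: two embeddings differ by `τ₀ ∈ Γ_K`, inner pairs act trivially on `H¹`,
  `map_one_eq_of_conj_comp`); and the on-the-nose agreement of the two composite pairs
  (`conjGalCMH_comp_resGalOfEmb_embOfLifts`, `pointsMapOfEmb_embOfLifts_comp_torsionMap`).
* `conjAct_mem_torsionLocalKer_iff` — the STRICT condition transports: `σ_* s ∈ torsionLocalKer E' ↔ s ∈ torsionLocalKer E`;
* `exists_transport_torsionLocMap_adicCompletion` — the case `E = K_v`, `E' = K_{σ • v}`.

What this does NOT do: (E2) (pairings), (E3) (signed local counts), (E4) (Weil); the comparison of the `torsionLocMap`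
model with the `galoisCohomology.localization` model is koly g13's `exists_addMonoidHom_comp_localization_eq_torsionLocMap`.

References: [cite: SerreLocalFields1979, VII §5 Prop. 3] [cite: SerreGaloisCohomology1997, I §2.4, II §1.1]
[cite: GrossLMS1991, §5 (5.1), Prop. 8.2] [cite: McCallumLMS1991, Lemma 5.3 (p. 303)] [cite: CasselsFrohlichANT1967, Ch. VII §1.1].
-/

noncomputable section

open scoped Classical

universe u

namespace Summit.BirchSwinnertonDyer.Rank1Residual.X11b.Three.Koly.ZhangSupply.LocalConj

open CategoryTheory WeierstrassCurve Field Function NumberField IsDedekindDomain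
open Literature.NumberTheory.EllipticCurves Literature.NumberTheory.Automorphic
open Literature.NumberTheory.GaloisRepresentations

section Transport

variable {K : Type u} [Field K] [CharZero K] (W : WeierstrassCurve ℚ)
variable {E E' : Type u} [Field E] [Algebra K E] [Field E'] [Algebra K E'] [CharZero E] [CharZero E']

/-! ## §1 The lift `Θ` on `n`-torsion local points -/

/-- **A lift `Θ : K̄_E ≃+* K̄_{E'}` acts on `n`-torsion local points**: there is an additive
`ψ : E(K̄_E)[n] → E(K̄_{E'})[n]` which is the tree's `localPointsMap W Θ` on underlying points (additive maps preserve
`n`-torsion). [folklore] -/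
theorem exists_torsionBy_map (Θ : AlgebraicClosure E ≃+* AlgebraicClosure E') (n : ℤ) :
    ∃ ψ : AddSubgroup.torsionBy (localPoints (W.baseChange K) E) n →+
        AddSubgroup.torsionBy (localPoints (W.baseChange K) E') n,
      ∀ P, (ψ P : localPoints (W.baseChange K) E') = localPointsMap (K := K) W Θ P := by
  refine ⟨((localPointsMap (K := K) W Θ).comp (AddSubgroup.torsionBy _ n).subtype).codRestrict _ fun P ↦ ?_,
    fun P ↦ rfl⟩
  have hP : n • (P : localPoints (W.baseChange K) E) = 0 :=
    (Submodule.mem_torsionBy_iff (R := ℤ) n (P : localPoints (W.baseChange K) E)).mp P.2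
  change localPointsMap (K := K) W Θ (P : localPoints (W.baseChange K) E) ∈
    (Submodule.torsionBy ℤ (localPoints (W.baseChange K) E') n).toAddSubgroup
  rw [Submodule.mem_toAddSubgroup, Submodule.mem_torsionBy_iff, ← map_zsmul, hP, map_zero]

/-- Such a `ψ` is compatible with the conjugation `Θ⁻¹(·)Θ : Γ_{E'} → Γ_E` (`IsLiftOfRingEquiv.conjGalCMH`):
`ψ (Θ⁻¹ g Θ • P) = g • ψ P` (from `IsLiftOfRingEquiv.localPointsMap_smul`). [folklore] -/
theorem smul_of_coe_eq_localPointsMap {θ : E ≃+* E'} {Θ : AlgebraicClosure E ≃+* AlgebraicClosure E'}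
    (hΘ : IsLiftOfRingEquiv θ Θ) {n : ℤ}
    (ψ : AddSubgroup.torsionBy (localPoints (W.baseChange K) E) n →+
      AddSubgroup.torsionBy (localPoints (W.baseChange K) E') n)
    (hψ : ∀ P, (ψ P : localPoints (W.baseChange K) E') = localPointsMap (K := K) W Θ P)
    (g : absoluteGaloisGroup E') (P : AddSubgroup.torsionBy (localPoints (W.baseChange K) E) n) :
    ψ (hΘ.conjGalCMH g • P) = g • ψ P := by
  apply Subtype.ext
  rw [hψ, Literature.NumberTheory.EllipticCurves.AddSubgroup.torsionBy.coe_smul,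
    Literature.NumberTheory.EllipticCurves.AddSubgroup.torsionBy.coe_smul, hψ]
  exact hΘ.localPointsMap_smul W g (P : localPoints (W.baseChange K) E)

/-- `ψ′ ∘ ψ = id` for the maps of `Θ` and `Θ⁻¹` on torsion points (`localPointsMap_symm_apply`). [folklore] -/
theorem comp_eq_id_of_coe_eq {Θ : AlgebraicClosure E ≃+* AlgebraicClosure E'} {n : ℤ}
    (ψ : AddSubgroup.torsionBy (localPoints (W.baseChange K) E) n →+
      AddSubgroup.torsionBy (localPoints (W.baseChange K) E') n)
    (hψ : ∀ P, (ψ P : localPoints (W.baseChange K) E') = localPointsMap (K := K) W Θ P)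
    (ψ' : AddSubgroup.torsionBy (localPoints (W.baseChange K) E') n →+
      AddSubgroup.torsionBy (localPoints (W.baseChange K) E) n)
    (hψ' : ∀ Q, (ψ' Q : localPoints (W.baseChange K) E) = localPointsMap (K := K) W Θ.symm Q) :
    ψ'.comp ψ = AddMonoidHom.id _ := by
  refine AddMonoidHom.ext fun P ↦ Subtype.ext ?_
  have h1 := hψ' (ψ P)
  rw [hψ P, localPointsMap_symm_apply W Θ (P : localPoints (W.baseChange K) E)] at h1
  exact h1

/-! ## §2 The transport `Φ` on `H¹` and its injectivity -/

/-- **The transport is injective**: for a lift `Θ` of `θ`, the map `H¹(Γ_E, E(K̄_E)[n]) → H¹(Γ_{E'}, E(K̄_{E'})[n])`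
induced by the compatible pair `(Θ⁻¹(·)Θ, Θ)` has the pair of `Θ⁻¹` as a left inverse (Mathlib
`ContinuousCohomology.map_comp`, `map_id`; the tree's `IsLiftOfRingEquiv.map_injective` for full local points).
[cite: SerreGaloisCohomology1997, I §2.4] -/
theorem map_torsion_injective {θ : E ≃+* E'} {Θ : AlgebraicClosure E ≃+* AlgebraicClosure E'}
    (hΘ : IsLiftOfRingEquiv θ Θ) {n : ℤ}
    (ψ : AddSubgroup.torsionBy (localPoints (W.baseChange K) E) n →+
      AddSubgroup.torsionBy (localPoints (W.baseChange K) E') n)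
    (hψ : ∀ P, (ψ P : localPoints (W.baseChange K) E') = localPointsMap (K := K) W Θ P) :
    Injective (ContinuousCohomology.map hΘ.conjGalCMH
      (resHomOfEquivariant hΘ.conjGalCMH ψ (smul_of_coe_eq_localPointsMap W hΘ ψ hψ)) 1) := by
  have hΘ' : IsLiftOfRingEquiv θ.symm Θ.symm := hΘ.symm
  obtain ⟨ψ', hψ'⟩ := exists_torsionBy_map (K := K) W Θ.symm n
  have hcomp := map_one_eq_comp_of_eq hΘ.conjGalCMH ψ (smul_of_coe_eq_localPointsMap W hΘ ψ hψ)
    hΘ'.conjGalCMH ψ' (smul_of_coe_eq_localPointsMap W hΘ' ψ' hψ')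
    (Φ := ContinuousMonoidHom.id _) (Ψ := AddMonoidHom.id _) (fun _ _ ↦ rfl)
    hΘ.conjGalCMH_comp_symm.symm (comp_eq_id_of_coe_eq W ψ hψ ψ' hψ').symm
  rw [map_one_eq_id_of_eq (fun _ _ ↦ rfl) rfl rfl] at hcomp
  intro a b hab
  have ha := congr($hcomp a)
  have hb := congr($hcomp b)
  simp only [ConcreteCategory.id_apply, ConcreteCategory.comp_apply] at ha hb
  rw [ha, hab, ← hb]

/-! ## §3 Independence of the embedding for the torsion localisation MAP -/

omit [CharZero E'] in
/-- **The torsion localisation map does not depend on the `K`-embedding `K̄ → K̄_{E'}`**: for any `ι` and any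
additive `ψι : E[n] → E(K̄_{E'})[n]` that is `pointsMapOfEmb ι` on points, the map `H¹(K, E[n]) → H¹(Γ_{E'}, E(K̄_{E'})[n])`
along `(res_ι, ψι)` equals the one along the chosen pair `(resGal E', torsionPointsMap E')`: two embeddings differ by
`τ₀ ∈ Γ_K` (`exists_algHom_eq_comp`), which changes the pair by the inner pair of `τ₀` (`resGalOfEmb_comp`,
`pointsMapOfEmb_comp_torsion`), and inner pairs act trivially on `H¹` (`map_one_eq_of_conj_comp`; Serre, *Corps locaux*
VII §5 Prop. 3 — the MAP form of the tree's `selmerLocalKer_eq_of_algHom_holds`). [cite: SerreLocalFields1979, VII §5 Prop. 3] -/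
theorem map_torsion_eq_of_algHom (ι : AlgebraicClosure K →ₐ[K] AlgebraicClosure E') (n : ℤ)
    (ψι : geomTorsion (W.baseChange K) n →+ AddSubgroup.torsionBy (localPoints (W.baseChange K) E') n)
    (hψι : ∀ P, (ψι P : localPoints (W.baseChange K) E') = pointsMapOfEmb (W.baseChange K) ι P)
    (hsmul : ∀ (g : absoluteGaloisGroup E') (P : geomTorsion (W.baseChange K) n),
      ψι (resGalOfEmb ι g • P) = g • ψι P) :
    ContinuousCohomology.map (resGalOfEmb ι) (resHomOfEquivariant (resGalOfEmb ι) ψι hsmul) 1 =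
      ContinuousCohomology.map (resGal (K := K) E')
        (resHomOfEquivariant (resGal (K := K) E') (torsionPointsMap (W.baseChange K) E' n)
          (torsionPointsMap_smul (W.baseChange K) E' n)) 1 := by
  obtain ⟨τ₀, rfl⟩ := exists_algHom_eq_comp (closureEmb (K := K) E') ι
  refine map_one_eq_of_conj_comp (resGal (K := K) E') (torsionPointsMap (W.baseChange K) E' n)
    (torsionPointsMap_smul (W.baseChange K) E' n) (show absoluteGaloisGroup K from τ₀) hsmul
    (resGalOfEmb_comp (closureEmb (K := K) E') τ₀) ?_
  refine AddMonoidHom.ext fun P ↦ Subtype.ext ?_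
  rw [hψι, AddMonoidHom.comp_apply, coe_torsionPointsMap]
  have h := congr($(pointsMapOfEmb_comp_torsion (W.baseChange K) (closureEmb (K := K) E') τ₀ n) P)
  simp only [AddMonoidHom.coe_comp, AddSubgroup.coe_subtype, Function.comp_apply] at h
  exact h

/-! ## §4 The transport theorem -/

/-- **(E1) LOCAL CONJUGATION TRANSPORT.** For `E = W/ℚ`, a field `K` of characteristic `0`, `σ ∈ Aut(K/ℚ)`, a
`σ`-semilinear ring isomorphism `θ : E ≃+* E'` of `K`-fields of characteristic `0` (e.g. the Galois transport of
completions `K_v ≃+* K_{σ v}`) and `n`, there is an INJECTIVE additive map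
`Φ : H¹(Γ_E, E(K̄_E)[n]) → H¹(Γ_{E'}, E(K̄_{E'})[n])` with `Φ (loc_E s) = loc_{E'} (σ_* s)` for every `s ∈ H¹(K, E[n])`
(`loc = WeierstrassCurve.torsionLocMap`, `σ_* = conjAct W σ n`). `Φ` is `H¹` of the compatible pair `(Θ⁻¹(·)Θ, Θ)` for a
lift `Θ : K̄_E ≃+* K̄_{E'}` of `θ`; the identity is the on-the-nose agreement of the composite pairs computing
`loc_{E'} ∘ σ_*` (through the embedding `ι' = Θ ι_E τ⁻¹`, allowed by `map_torsion_eq_of_algHom`) and `Φ ∘ loc_E`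
(`conjGalCMH_comp_resGalOfEmb_embOfLifts`, `pointsMapOfEmb_embOfLifts_comp_torsionMap`). Torsion-coefficient analogue of
the tree's `conjAct_mem_selmerLocalKer_iff`. [cite: SerreGaloisCohomology1997, I §2.4, II §1.1]
[cite: GrossLMS1991, §5 (5.1)] [cite: CasselsFrohlichANT1967, Ch. VII §1.1] -/
theorem exists_transport_torsionLocMap (σ : K ≃ₐ[ℚ] K) (θ : E ≃+* E') (hθ : IsSemilinearRingEquiv σ θ) (n : ℤ) :
    ∃ Φ : discreteH1 (absoluteGaloisGroup E) (AddSubgroup.torsionBy (localPoints (W.baseChange K) E) n) →+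
        discreteH1 (absoluteGaloisGroup E') (AddSubgroup.torsionBy (localPoints (W.baseChange K) E') n),
      Injective Φ ∧ ∀ s : galH1Torsion (W.baseChange K) n,
        Φ ((W.baseChange K).torsionLocMap E n s) = (W.baseChange K).torsionLocMap E' n (conjAct W σ n s) := by
  have hτ : IsLiftOfAut σ (liftAut σ) := isLiftOfAut_liftAut σ
  have hΘ : IsLiftOfRingEquiv θ (ringEquivLift θ) := isLiftOfRingEquiv_ringEquivLift θ
  obtain ⟨ψ, hψ⟩ := exists_torsionBy_map (K := K) W (ringEquivLift θ) n
  set ι' := embOfLifts hτ hθ hΘ with hι'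
  -- the torsion points map along `ι'`
  obtain ⟨ψι, hψι⟩ : ∃ ψι : geomTorsion (W.baseChange K) n →+
      AddSubgroup.torsionBy (localPoints (W.baseChange K) E') n,
      ∀ P, (ψι P : localPoints (W.baseChange K) E') = pointsMapOfEmb (W.baseChange K) ι' P := by
    refine ⟨((pointsMapOfEmb (W.baseChange K) ι').comp (geomTorsion (W.baseChange K) n).subtype).codRestrict _
      fun P ↦ ?_, fun P ↦ rfl⟩
    have hP : n • (P : geomPoints (W.baseChange K)) = 0 := (mem_geomTorsion_iff (W.baseChange K) n _).mp P.2
    change pointsMapOfEmb (W.baseChange K) ι' (P : geomPoints (W.baseChange K)) ∈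
      (Submodule.torsionBy ℤ (localPoints (W.baseChange K) E') n).toAddSubgroup
    rw [Submodule.mem_toAddSubgroup, Submodule.mem_torsionBy_iff, ← map_zsmul, hP, map_zero]
  have hsmulι : ∀ (g : absoluteGaloisGroup E') (P : geomTorsion (W.baseChange K) n),
      ψι (resGalOfEmb ι' g • P) = g • ψι P := fun g P ↦ Subtype.ext (by
    rw [hψι, Literature.NumberTheory.EllipticCurves.AddSubgroup.torsionBy.coe_smul,
      Literature.NumberTheory.EllipticCurves.AddSubgroup.torsionBy.coe_smul, hψι]
    exact pointsMapOfEmb_smul _ ι' g _)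
  refine ⟨(ContinuousCohomology.map hΘ.conjGalCMH
      (resHomOfEquivariant hΘ.conjGalCMH ψ (smul_of_coe_eq_localPointsMap W hΘ ψ hψ)) 1).hom.toLinearMap.toAddMonoidHom,
    fun a b h ↦ map_torsion_injective W hΘ ψ hψ h, fun s ↦ ?_⟩
  -- (A) `loc_{E', ι'} ∘ σ_*` as ONE compatible pair
  have hA := map_one_eq_comp_of_eq hτ.conjGalCMH (hτ.torsionMap W n) (hτ.torsionMap_smul W n)
    (resGalOfEmb ι') ψι hsmulι
    (Φ := hτ.conjGalCMH.comp (resGalOfEmb ι')) (Ψ := ψι.comp (hτ.torsionMap W n))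
    (fun g P ↦ by
      rw [AddMonoidHom.comp_apply, ContinuousMonoidHom.comp_toFun, hτ.torsionMap_smul W n, hsmulι,
        AddMonoidHom.comp_apply]) rfl rfl
  -- (B) `Φ ∘ loc_E` as ONE compatible pair
  have hB := map_one_eq_comp_of_eq (resGal (K := K) E) (torsionPointsMap (W.baseChange K) E n)
    (torsionPointsMap_smul (W.baseChange K) E n) hΘ.conjGalCMH ψ (smul_of_coe_eq_localPointsMap W hΘ ψ hψ)
    (Φ := (resGal (K := K) E).comp hΘ.conjGalCMH) (Ψ := ψ.comp (torsionPointsMap (W.baseChange K) E n))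
    (fun g P ↦ by
      rw [AddMonoidHom.comp_apply, ContinuousMonoidHom.comp_toFun, torsionPointsMap_smul,
        smul_of_coe_eq_localPointsMap W hΘ ψ hψ, AddMonoidHom.comp_apply]) rfl rfl
  -- the two composite pairs agree on the nose
  have hcoef : ψι.comp (hτ.torsionMap W n) = ψ.comp (torsionPointsMap (W.baseChange K) E n) := by
    refine AddMonoidHom.ext fun P ↦ Subtype.ext ?_
    rw [AddMonoidHom.comp_apply, AddMonoidHom.comp_apply, hψι, hψ, coe_torsionPointsMap]
    have h := congr($(pointsMapOfEmb_embOfLifts_comp_torsionMap W hτ hθ hΘ n) P)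
    simpa only [AddMonoidHom.coe_comp, AddSubgroup.coe_subtype, Function.comp_apply] using h
  have hAB := map_one_pair_congr (conjGalCMH_comp_resGalOfEmb_embOfLifts hτ hθ hΘ) hcoef
    (fun g P ↦ by
      rw [AddMonoidHom.comp_apply, ContinuousMonoidHom.comp_toFun, hτ.torsionMap_smul W n, hsmulι,
        AddMonoidHom.comp_apply])
    (fun g P ↦ by
      rw [AddMonoidHom.comp_apply, ContinuousMonoidHom.comp_toFun, torsionPointsMap_smul,
        smul_of_coe_eq_localPointsMap W hΘ ψ hψ, AddMonoidHom.comp_apply])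
  rw [hA, hB, map_torsion_eq_of_algHom W ι' n ψι hψι hsmulι] at hAB
  -- evaluate at `s`
  rw [← hτ.conjH1_eq_conjAct W n]
  unfold WeierstrassCurve.torsionLocMap IsLiftOfAut.conjH1
  simp only [LinearMap.toAddMonoidHom_coe, ContinuousLinearMap.coe_coe]
  rw [← ConcreteCategory.comp_apply, ← ConcreteCategory.comp_apply, hAB]

/-! ## §5 Consequences: transport of the strict condition; the Galois transport of completions -/

/-- **The STRICT local condition transports**: `σ_* s ∈ torsionLocalKer E' ↔ s ∈ torsionLocalKer E` (`loc_{E'} (σ_* s) = 0`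
iff `Φ (loc_E s) = 0` iff `loc_E s = 0`, `Φ` injective) — the `E[n]`-coefficient companion of the tree's
`conjAct_mem_selmerLocalKer_iff` (Kummer condition). [cite: GrossLMS1991, Prop. 8.2] -/
theorem conjAct_mem_torsionLocalKer_iff (σ : K ≃ₐ[ℚ] K) (θ : E ≃+* E') (hθ : IsSemilinearRingEquiv σ θ) (n : ℤ)
    (s : galH1Torsion (W.baseChange K) n) :
    conjAct W σ n s ∈ (W.baseChange K).torsionLocalKer E' n ↔ s ∈ (W.baseChange K).torsionLocalKer E n := by
  obtain ⟨Φ, hinj, hΦ⟩ := exists_transport_torsionLocMap (K := K) W (E := E) (E' := E') σ θ hθ n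
  change (W.baseChange K).torsionLocMap E' n (conjAct W σ n s) = 0 ↔ (W.baseChange K).torsionLocMap E n s = 0
  rw [← hΦ]
  constructor
  · intro h
    exact hinj (h.trans (map_zero Φ).symm)
  · intro h
    rw [h, map_zero]

end Transport

section Completion

variable {K : Type} [Field K] [NumberField K] (W : WeierstrassCurve ℚ)

/-- **(E1) at the finite places**: for `σ ∈ Aut(K/ℚ)` and finite places `v`, `v' = σ • v` of the number field `K`, an
INJECTIVE additive `Φ : H¹(Γ_{K_v}, E(K̄_{K_v})[n]) → H¹(Γ_{K_{v'}}, E(K̄_{K_{v'}})[n])` with `Φ (loc_v s) = loc_{v'} (σ_* s)`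
for all `s ∈ H¹(K, E[n])` — the Galois transport of completions `σ_v : K_v ≃+* K_{σ v}` (tree
`galAdicCompletionEquiv`, `σ`-semilinear by `isSemilinearRingEquiv_galAdicCompletionEquiv`; Cassels–Fröhlich Ch. VII
§1.1) fed to `exists_transport_torsionLocMap`. For `K` imaginary quadratic, `σ` = complex conjugation and `v` inert
(`σ • v = v`) this is the action of `τ` on `H¹(K_λ, E[p])` of Gross 1991 §§5, 8 in the method skeleton's model.
[cite: CasselsFrohlichANT1967, Ch. VII §1.1] [cite: GrossLMS1991, §5 (5.1), Prop. 8.2] -/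
theorem exists_transport_torsionLocMap_adicCompletion (σ : K ≃ₐ[ℚ] K) {v v' : HeightOneSpectrum (𝓞 K)}
    (h : σ • v = v') (n : ℤ) :
    ∃ Φ : discreteH1 (absoluteGaloisGroup (v.adicCompletion K))
          (AddSubgroup.torsionBy (localPoints (W.baseChange K) (v.adicCompletion K)) n) →+
        discreteH1 (absoluteGaloisGroup (v'.adicCompletion K))
          (AddSubgroup.torsionBy (localPoints (W.baseChange K) (v'.adicCompletion K)) n),
      Injective Φ ∧ ∀ s : galH1Torsion (W.baseChange K) n,
        Φ ((W.baseChange K).torsionLocMap (v.adicCompletion K) n s) =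
          (W.baseChange K).torsionLocMap (v'.adicCompletion K) n (conjAct W σ n s) := by
  haveI : CharZero (v.adicCompletion K) := charZero_of_injective_algebraMap (algebraMap K _).injective
  haveI : CharZero (v'.adicCompletion K) := charZero_of_injective_algebraMap (algebraMap K _).injective
  exact exists_transport_torsionLocMap (K := K) W σ (galAdicCompletionEquiv (L := K) σ h)
    (isSemilinearRingEquiv_galAdicCompletionEquiv σ h) n

/-- The strict condition at `v` transports to the strict condition at `σ • v`:
`σ_* s ∈ torsionLocalKer K_{σ•v} ↔ s ∈ torsionLocalKer K_v`. [cite: GrossLMS1991, Prop. 8.2] -/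
theorem conjAct_mem_torsionLocalKer_adicCompletion_iff (σ : K ≃ₐ[ℚ] K) {v v' : HeightOneSpectrum (𝓞 K)}
    (h : σ • v = v') (n : ℤ) (s : galH1Torsion (W.baseChange K) n) :
    conjAct W σ n s ∈ (W.baseChange K).torsionLocalKer (v'.adicCompletion K) n ↔
      s ∈ (W.baseChange K).torsionLocalKer (v.adicCompletion K) n := by
  haveI : CharZero (v.adicCompletion K) := charZero_of_injective_algebraMap (algebraMap K _).injective
  haveI : CharZero (v'.adicCompletion K) := charZero_of_injective_algebraMap (algebraMap K _).injective
  exact conjAct_mem_torsionLocalKer_iff (K := K) W σ (galAdicCompletionEquiv (L := K) σ h)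
    (isSemilinearRingEquiv_galAdicCompletionEquiv σ h) n s

end Completion


end Summit.BirchSwinnertonDyer.Rank1Residual.X11b.Three.Koly.ZhangSupply.LocalConj

end
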